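import Mathlib
import HarnessLib

/-!
# Crux `ExtremalSpiralSymmetry` (stmt-NavierStokesRegularity-8215), line `registered`, stub 3c-i
# `stub_stabiliserClosedSubgroup`: the stabiliser of a field as a closed linear group

Support file (theorems only, `--supports stmt-NavierStokesRegularity-8215`; no definitions — `Aff(…)`, `Stab(…)`, `𝕍` are
file-local notations, identical to the skeleton's). Lead c1.

For a field `u : ℝ → ℝ³ → ℝ³` write `S_c u (t,x) = c u(c²t, cx)` and `g_{b,R} u (t,x) = R u(t, R⁻¹(x - b))`.
The rigid parabolic scaling symmetries `{(c, R, b) : S_c u = g_{b,R} u on t < 0}` form a group under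
`(c,R,b)(c',R',b') = (cc', RR', R b' + b/c')`, and the map `(c, R, b) ↦ (Aff(c, R, c b), c, c⁻¹)`, where
`Aff(c, R, d)` is the linear map `(y, r) ↦ (c R y + r d, r)` of `ℝ³ × ℝ` (the affine map `y ↦ cRy + d` in homogeneous
coordinates), is an injective homomorphism into the unit group of the finite-dimensional real Banach algebra
`𝕍 = End(ℝ³ × ℝ) × ℝ × ℝ`. This file proves that the image `Stab(u)` contains `1`, is closed under products, has
left inverses, and — when `u` is continuous on the open slab `t < 0` — is CLOSED in `𝕍` (limits of isometries are
isometries; the coordinate `c⁻¹` keeps `c` away from `0`) — packaged as the registered stub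
`stub_stabiliserClosedSubgroup`. Stub 3c-ii (`…StubSymmetryFamily.lean`) feeds this to the closed-subgroup character
lemma (stub 3a) and reads the one-parameter family off `exp(sX)`.
-/

noncomputable section

-- the summit and its single sub-problem share the name (CONVENTIONS §1), as in every Theorems file
set_option linter.dupNamespace false

open Filter Topology Set

namespace Summit.NavierStokesRegularity.NavierStokesRegularity.Theorems.ExtremalSpiralSymmetry.Registered

/-- Local notation for physical space `ℝ³`. -/
local notation "E3" => EuclideanSpace ℝ (Fin 3)

/-- The ambient algebra `End(ℝ³ × ℝ) × ℝ × ℝ`. -/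
local notation "𝕍" => ((EuclideanSpace ℝ (Fin 3) × ℝ) →L[ℝ] (EuclideanSpace ℝ (Fin 3) × ℝ)) × ℝ × ℝ

/-- `Aff(c, R, d)` : the linear map `(y, r) ↦ (c • R y + r • d, r)` of `ℝ³ × ℝ`. -/
local notation "Aff(" c ", " R ", " d ")" =>
  (ContinuousLinearMap.prod
    (ContinuousLinearMap.comp ((c : ℝ) • (R : EuclideanSpace ℝ (Fin 3) →L[ℝ] EuclideanSpace ℝ (Fin 3)))
        (ContinuousLinearMap.fst ℝ (EuclideanSpace ℝ (Fin 3)) ℝ) +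
      ContinuousLinearMap.smulRight (ContinuousLinearMap.snd ℝ (EuclideanSpace ℝ (Fin 3)) ℝ)
        (d : EuclideanSpace ℝ (Fin 3)))
    (ContinuousLinearMap.snd ℝ (EuclideanSpace ℝ (Fin 3)) ℝ))

-- `quotPrecheck` cannot look under the binders of this notation (it is a plain macro; nothing is hidden)
set_option quotPrecheck false in
/-- `Stab(u)` : the image in `𝕍` of the group of rigid parabolic scaling symmetries of `u` on `t < 0`. -/
local notation "Stab(" u ")" =>
  (setOf fun M : 𝕍 =>
    ∃ (c : ℝ) (R : EuclideanSpace ℝ (Fin 3) ≃ₗᵢ[ℝ] EuclideanSpace ℝ (Fin 3)) (b : EuclideanSpace ℝ (Fin 3)),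
      0 < c ∧ M = (Aff(c, (R : EuclideanSpace ℝ (Fin 3) →L[ℝ] EuclideanSpace ℝ (Fin 3)), c • b), c, c⁻¹) ∧
      ∀ t < (0:ℝ), ∀ x, c • u (c ^ 2 * t) (c • x) = R (u t (LinearIsometryEquiv.symm R (x - b))))

/-- Evaluation of `Aff(c, R, d)`. [folklore] -/
theorem aff_apply (c : ℝ) (R : E3 →L[ℝ] E3) (d : E3) (y : E3) (r : ℝ) :
    Aff(c, R, d) (y, r) = (c • R y + r • d, r) := by
  simp

/-- Composition of two `Aff`s is an `Aff` (the similarity group law). [folklore] -/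
theorem aff_comp (c c' : ℝ) (R R' : E3 →L[ℝ] E3) (d d' : E3) :
    (Aff(c, R, d)).comp (Aff(c', R', d')) = Aff(c * c', R.comp R', c • R d' + d) := by
  refine ContinuousLinearMap.ext fun v => ?_
  obtain ⟨y, r⟩ := v
  rw [ContinuousLinearMap.comp_apply, aff_apply, aff_apply, aff_apply]
  refine Prod.ext ?_ rfl
  simp only [map_add, map_smul, ContinuousLinearMap.comp_apply, smul_add, smul_smul, mul_comm r c]
  rw [mul_smul, mul_smul]
  abel

/-- `Aff(1, id, 0)` is the identity. [folklore] -/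
theorem aff_one : Aff((1:ℝ), ContinuousLinearMap.id ℝ E3, (0 : E3)) = 1 := by
  refine ContinuousLinearMap.ext fun v => ?_
  obtain ⟨y, r⟩ := v
  rw [aff_apply]
  simp

/-- The `ℝ³`-block of `Aff(c, R, d)` is `c • R`. [folklore] -/
theorem fst_aff_inl (c : ℝ) (R : E3 →L[ℝ] E3) (d : E3) :
    (ContinuousLinearMap.fst ℝ E3 ℝ).comp ((Aff(c, R, d)).comp (ContinuousLinearMap.inl ℝ E3 ℝ)) = c • R := by
  refine ContinuousLinearMap.ext fun y => ?_
  rw [ContinuousLinearMap.comp_apply, ContinuousLinearMap.comp_apply, ContinuousLinearMap.inl_apply, aff_apply]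
  simp

/-- The translation part of `Aff(c, R, d)` is `d`. [folklore] -/
theorem aff_apply_zero_one (c : ℝ) (R : E3 →L[ℝ] E3) (d : E3) :
    (Aff(c, R, d) ((0 : E3), (1 : ℝ))).1 = d := by
  rw [aff_apply]
  simp

/-! ### Group structure of `Stab(u)` -/

section Group

variable (u : ℝ → E3 → E3)

/-- `1 ∈ Stab(u)` (the trivial symmetry `(1, id, 0)`). [folklore] -/
theorem one_mem_stab : (1 : 𝕍) ∈ Stab(u) := by
  refine ⟨1, LinearIsometryEquiv.refl ℝ E3, 0, one_pos, ?_, ?_⟩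
  · rw [smul_zero]
    refine Prod.ext ?_ (Prod.ext rfl (by simp))
    change (1 : (E3 × ℝ) →L[ℝ] (E3 × ℝ)) = _
    rw [← aff_one]
    rfl
  · intro t _ x
    rw [one_smul, one_pow, one_mul, one_smul, sub_zero]
    rfl

/-- Coercion of a composite of linear isometry equivalences to continuous linear maps. [folklore] -/
theorem coe_trans_eq_comp (R R' : E3 ≃ₗᵢ[ℝ] E3) :
    ((R'.trans R : E3 ≃ₗᵢ[ℝ] E3) : E3 →L[ℝ] E3) = (R : E3 →L[ℝ] E3).comp (R' : E3 →L[ℝ] E3) := by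
  ext y
  simp

/-- `Stab(u)` is closed under products: the symmetries `(c, R, b)` and `(c', R', b')` compose to
`(cc', RR', R b' + c'⁻¹ b)`. [folklore] -/
theorem mul_mem_stab {M M' : 𝕍} (hM : M ∈ Stab(u)) (hM' : M' ∈ Stab(u)) : M * M' ∈ Stab(u) := by
  obtain ⟨c, R, b, hc, rfl, hsym⟩ := hM
  obtain ⟨c', R', b', hc', rfl, hsym'⟩ := hM'
  refine ⟨c * c', R'.trans R, R b' + c'⁻¹ • b, mul_pos hc hc', ?_, ?_⟩
  · refine Prod.ext ?_ (Prod.ext rfl (by simp [mul_comm]))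
    change (Aff(c, (R : E3 →L[ℝ] E3), c • b)).comp (Aff(c', (R' : E3 →L[ℝ] E3), c' • b')) = _
    have e1 : c • (R : E3 →L[ℝ] E3) (c' • b') + c • b = (c * c') • (R b' + c'⁻¹ • b) := by
      rw [map_smul, smul_smul, smul_add, smul_smul, mul_assoc, mul_inv_cancel₀ hc'.ne', mul_one, mul_comm c c']
      rfl
    rw [aff_comp, e1, coe_trans_eq_comp]
  · intro t ht x
    have ht' : c' ^ 2 * t < 0 := mul_neg_of_pos_of_neg (by positivity) ht
    have h1 := hsym (c' ^ 2 * t) ht' (c' • x)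
    have h2 := hsym' t ht (R.symm (x - c'⁻¹ • b))
    have e1 : (c * c') ^ 2 * t = c ^ 2 * (c' ^ 2 * t) := by ring
    have e3 : c' • R.symm (x - c'⁻¹ • b) = R.symm (c' • x - b) := by
      rw [← map_smul, smul_sub, smul_smul, mul_inv_cancel₀ hc'.ne', one_smul]
    rw [e3] at h2
    have h3 : u (c' ^ 2 * t) (R.symm (c' • x - b)) =
        c'⁻¹ • R' (u t (R'.symm (R.symm (x - c'⁻¹ • b) - b'))) := by
      rw [← h2, smul_smul, inv_mul_cancel₀ hc'.ne', one_smul]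
    have e4 : (R'.trans R) (R'.symm (R.symm (x - c'⁻¹ • b) - b')) = x - (R b' + c'⁻¹ • b) := by
      simp only [LinearIsometryEquiv.trans_apply, map_sub, LinearIsometryEquiv.apply_symm_apply]
      abel
    have e5 : (R'.trans R).symm (x - (R b' + c'⁻¹ • b)) = R'.symm (R.symm (x - c'⁻¹ • b) - b') := by
      rw [← e4, LinearIsometryEquiv.symm_apply_apply]
    have e2 : (c * c') • x = c • (c' • x) := mul_smul c c' x
    have e6 : (c * c') • u (c ^ 2 * (c' ^ 2 * t)) (c • (c' • x)) = c' • (c • u (c ^ 2 * (c' ^ 2 * t)) (c • (c' • x))) := by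
      rw [mul_comm, mul_smul]
    rw [e1, e2, e6, h1, h3, map_smul, smul_smul, mul_inv_cancel₀ hc'.ne', one_smul,
      LinearIsometryEquiv.trans_apply, e5]

/-- Every element of `Stab(u)` has a left inverse in `Stab(u)`: `(c, R, b)⁻¹ = (c⁻¹, R⁻¹, -c R⁻¹ b)`. [folklore] -/
theorem exists_left_inv_mem_stab {M : 𝕍} (hM : M ∈ Stab(u)) : ∃ N ∈ Stab(u), N * M = 1 := by
  obtain ⟨c, R, b, hc, rfl, hsym⟩ := hM
  refine ⟨(Aff(c⁻¹, (R.symm : E3 →L[ℝ] E3), c⁻¹ • (-(c • R.symm b))), c⁻¹, c⁻¹⁻¹),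
    ⟨c⁻¹, R.symm, -(c • R.symm b), inv_pos.2 hc, rfl, ?_⟩, ?_⟩
  · intro t ht x
    have ht' : (c ^ 2)⁻¹ * t < 0 := mul_neg_of_pos_of_neg (by positivity) ht
    have h1 := hsym ((c ^ 2)⁻¹ * t) ht' (R (c⁻¹ • x) + b)
    rw [← mul_assoc, mul_inv_cancel₀ (by positivity), one_mul, add_sub_cancel_right,
      LinearIsometryEquiv.symm_apply_apply] at h1
    -- `h1 : c • u t (c • (R (c⁻¹ • x) + b)) = R (u ((c ^ 2)⁻¹ * t) (c⁻¹ • x))`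
    have h2 : u ((c ^ 2)⁻¹ * t) (c⁻¹ • x) = c • R.symm (u t (c • (R (c⁻¹ • x) + b))) := by
      rw [← map_smul, h1, LinearIsometryEquiv.symm_apply_apply]
    have e1 : c • (R (c⁻¹ • x) + b) = R.symm.symm (x - -(c • R.symm b)) := by
      rw [LinearIsometryEquiv.symm_symm, smul_add, ← map_smul, smul_smul, mul_inv_cancel₀ hc.ne', one_smul,
        sub_neg_eq_add, map_add, map_smul, LinearIsometryEquiv.apply_symm_apply]
    rw [inv_pow, h2, smul_smul, inv_mul_cancel₀ hc.ne', one_smul, e1]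
  · refine Prod.ext ?_ (Prod.ext (by simp [inv_mul_cancel₀ hc.ne']) (by simp [mul_inv_cancel₀ hc.ne']))
    change (Aff(c⁻¹, (R.symm : E3 →L[ℝ] E3), c⁻¹ • (-(c • R.symm b)))).comp
      (Aff(c, (R : E3 →L[ℝ] E3), c • b)) = 1
    have e2 : (R.symm : E3 →L[ℝ] E3).comp (R : E3 →L[ℝ] E3) = ContinuousLinearMap.id ℝ E3 := by
      ext y
      simp
    have e3 : c⁻¹ • (R.symm : E3 →L[ℝ] E3) (c • b) + c⁻¹ • -(c • R.symm b) = 0 := by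
      rw [map_smul, smul_neg, ← sub_eq_add_neg, sub_eq_zero]
      rfl
    rw [aff_comp, inv_mul_cancel₀ hc.ne', e2, e3, aff_one]

end Group

/-! ### Closedness of `Stab(u)` for a continuous field -/

section Closed

variable {u : ℝ → E3 → E3}

/-- Pointwise-convergent isometries: images of a convergent sequence converge. [folklore] -/
theorem tendsto_isometry_apply {R : ℕ → E3 ≃ₗᵢ[ℝ] E3} {S : E3 ≃ₗᵢ[ℝ] E3}
    (hR : ∀ y, Tendsto (fun n => R n y) atTop (𝓝 (S y))) {w : ℕ → E3} {z : E3}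
    (hw : Tendsto w atTop (𝓝 z)) : Tendsto (fun n => R n (w n)) atTop (𝓝 (S z)) := by
  rw [tendsto_iff_norm_sub_tendsto_zero]
  have hb : Tendsto (fun n => ‖w n - z‖ + ‖R n z - S z‖) atTop (𝓝 0) := by
    have h1 : Tendsto (fun n => ‖w n - z‖) atTop (𝓝 0) := tendsto_iff_norm_sub_tendsto_zero.1 hw
    have h2 : Tendsto (fun n => ‖R n z - S z‖) atTop (𝓝 0) := tendsto_iff_norm_sub_tendsto_zero.1 (hR z)
    simpa using h1.add h2
  refine squeeze_zero (fun n => norm_nonneg _) (fun n => ?_) hb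
  calc ‖R n (w n) - S z‖ = ‖R n (w n - z) + (R n z - S z)‖ := by
        rw [map_sub]; congr 1; abel
    _ ≤ ‖R n (w n - z)‖ + ‖R n z - S z‖ := norm_add_le _ _
    _ = ‖w n - z‖ + ‖R n z - S z‖ := by rw [(R n).norm_map]

/-- Pointwise-convergent isometries: preimages of a convergent sequence converge. [folklore] -/
theorem tendsto_isometry_symm_apply {R : ℕ → E3 ≃ₗᵢ[ℝ] E3} {S : E3 ≃ₗᵢ[ℝ] E3}
    (hR : ∀ y, Tendsto (fun n => R n y) atTop (𝓝 (S y))) {w : ℕ → E3} {z : E3}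
    (hw : Tendsto w atTop (𝓝 z)) : Tendsto (fun n => (R n).symm (w n)) atTop (𝓝 (S.symm z)) := by
  rw [tendsto_iff_norm_sub_tendsto_zero]
  have h : ∀ n, ‖(R n).symm (w n) - S.symm z‖ = ‖w n - R n (S.symm z)‖ := fun n => by
    rw [← (R n).norm_map, map_sub, LinearIsometryEquiv.apply_symm_apply]
  simp_rw [h]
  have h2 : Tendsto (fun n => w n - R n (S.symm z)) atTop (𝓝 (z - S (S.symm z))) := hw.sub (hR _)
  rw [LinearIsometryEquiv.apply_symm_apply, sub_self] at h2
  simpa using h2.norm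

/-- **The stabiliser is closed.** If `u` is continuous on the open slab `t < 0`, then `Stab(u)` is a closed
subset of `𝕍`: along a convergent sequence `(Aff(cₙ, Rₙ, cₙbₙ), cₙ, cₙ⁻¹)` the factors `cₙ` converge to some
`γ > 0` (the coordinate `cₙ⁻¹` converges too), the isometries `Rₙ` converge to an isometry and the `bₙ` converge,
and the symmetry identity passes to the limit by continuity of `u`. [folklore] -/
theorem isClosed_stab (hu : ContinuousOn (Function.uncurry u) (Set.Iio 0 ×ˢ Set.univ)) :
    IsClosed Stab(u) := by
  refine IsSeqClosed.isClosed fun M L hMmem hlim => ?_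
  choose c R b hc hM hsym using hMmem
  -- the scalar components
  have hc_t : Tendsto c atTop (𝓝 L.2.1) := by
    have h := (continuous_fst.comp continuous_snd).continuousAt.tendsto.comp hlim
    refine h.congr fun n => ?_
    simp only [Function.comp_apply, hM n]
  have hci_t : Tendsto (fun n => (c n)⁻¹) atTop (𝓝 L.2.2) := by
    have h := (continuous_snd.comp continuous_snd).continuousAt.tendsto.comp hlim
    refine h.congr fun n => ?_
    simp only [Function.comp_apply, hM n]
  set γ := L.2.1 with hγ
  have hγinv : γ * L.2.2 = 1 := by
    have h1 : Tendsto (fun n => c n * (c n)⁻¹) atTop (𝓝 (γ * L.2.2)) := hc_t.mul hci_t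
    have h2 : (fun n => c n * (c n)⁻¹) = fun _ => (1 : ℝ) := funext fun n => mul_inv_cancel₀ (hc n).ne'
    rw [h2, tendsto_const_nhds_iff] at h1
    exact h1.symm
  have hγpos : 0 < γ := by
    have hge : 0 ≤ γ := ge_of_tendsto' hc_t fun n => (hc n).le
    rcases hge.lt_or_eq with h | h
    · exact h
    · exfalso
      rw [← h, zero_mul] at hγinv
      exact zero_ne_one hγinv
  have hL22 : L.2.2 = γ⁻¹ := (eq_inv_of_mul_eq_one_right hγinv)
  have hci_t' : Tendsto (fun n => (c n)⁻¹) atTop (𝓝 γ⁻¹) := hL22 ▸ hci_t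
  -- the affine part
  have hP_t : Tendsto (fun n => (M n).1) atTop (𝓝 L.1) := continuous_fst.continuousAt.tendsto.comp hlim
  -- the rotation block
  set Bl : E3 →L[ℝ] E3 :=
    (ContinuousLinearMap.fst ℝ E3 ℝ).comp (L.1.comp (ContinuousLinearMap.inl ℝ E3 ℝ)) with hBl
  have hB_t : Tendsto (fun n => c n • (R n : E3 →L[ℝ] E3)) atTop (𝓝 Bl) := by
    have hcont : Continuous fun P : (E3 × ℝ) →L[ℝ] (E3 × ℝ) =>
        (ContinuousLinearMap.fst ℝ E3 ℝ).comp (P.comp (ContinuousLinearMap.inl ℝ E3 ℝ)) :=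
      continuous_const.clm_comp (continuous_id.clm_comp continuous_const)
    have h := hcont.continuousAt.tendsto.comp hP_t
    refine h.congr fun n => ?_
    simp only [Function.comp_apply, hM n]
    exact fst_aff_inl _ _ _
  have hR_t : Tendsto (fun n => (R n : E3 →L[ℝ] E3)) atTop (𝓝 (γ⁻¹ • Bl)) := by
    refine (hci_t'.smul hB_t).congr fun n => ?_
    rw [smul_smul, inv_mul_cancel₀ (hc n).ne', one_smul]
  have hRy : ∀ y, Tendsto (fun n => R n y) atTop (𝓝 ((γ⁻¹ • Bl) y)) := fun y => by
    have h := ((ContinuousLinearMap.apply ℝ E3 y).continuous.tendsto _).comp hR_t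
    refine h.congr fun n => ?_
    simp
  -- the limit rotation is an isometry
  have hnorm : ∀ y, ‖(γ⁻¹ • Bl) y‖ = ‖y‖ := fun y => by
    have h1 := (hRy y).norm
    have h2 : (fun n => ‖R n y‖) = fun _ => ‖y‖ := funext fun n => (R n).norm_map y
    rw [h2, tendsto_const_nhds_iff] at h1
    exact h1.symm
  let Rli : E3 →ₗᵢ[ℝ] E3 := ⟨(γ⁻¹ • Bl).toLinearMap, hnorm⟩
  let S : E3 ≃ₗᵢ[ℝ] E3 := Rli.toLinearIsometryEquiv rfl
  have hS : ∀ y, S y = (γ⁻¹ • Bl) y := fun y => rfl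
  have hScoe : (S : E3 →L[ℝ] E3) = γ⁻¹ • Bl := ContinuousLinearMap.ext fun y => by
    rw [← hS y]; rfl
  have hRy' : ∀ y, Tendsto (fun n => R n y) atTop (𝓝 (S y)) := fun y => by rw [hS]; exact hRy y
  -- the translation part
  set Tl : E3 := (L.1 ((0 : E3), (1 : ℝ))).1 with hTl
  have hT_t : Tendsto (fun n => c n • b n) atTop (𝓝 Tl) := by
    have hcont : Continuous fun P : (E3 × ℝ) →L[ℝ] (E3 × ℝ) => (P ((0 : E3), (1 : ℝ))).1 :=
      continuous_fst.comp (ContinuousLinearMap.apply ℝ (E3 × ℝ) ((0 : E3), (1 : ℝ))).continuous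
    have h := hcont.continuousAt.tendsto.comp hP_t
    refine h.congr fun n => ?_
    simp only [Function.comp_apply, hM n]
    exact aff_apply_zero_one _ _ _
  have hb_t : Tendsto b atTop (𝓝 (γ⁻¹ • Tl)) := by
    refine (hci_t'.smul hT_t).congr fun n => ?_
    rw [smul_smul, inv_mul_cancel₀ (hc n).ne', one_smul]
  -- conclude: `L` is the image of the symmetry `(γ, S, γ⁻¹ Tl)`
  refine ⟨γ, S, γ⁻¹ • Tl, hγpos, ?_, ?_⟩
  · refine Prod.ext ?_ (Prod.ext rfl hL22)
    refine ContinuousLinearMap.ext fun v => ?_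
    obtain ⟨y, r⟩ := v
    have hlhs : Tendsto (fun n => (M n).1 (y, r)) atTop (𝓝 (L.1 (y, r))) :=
      ((ContinuousLinearMap.apply ℝ (E3 × ℝ) (y, r)).continuous.tendsto _).comp hP_t
    have hrhs : Tendsto (fun n => (M n).1 (y, r)) atTop (𝓝 (γ • S y + r • (γ • (γ⁻¹ • Tl)), r)) := by
      have h : ∀ n, (M n).1 (y, r) = (c n • R n y + r • (c n • b n), r) := fun n => by
        rw [hM n]; exact aff_apply _ _ _ _ _
      simp_rw [h]
      refine Tendsto.prodMk_nhds ?_ tendsto_const_nhds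
      rw [smul_smul γ, mul_inv_cancel₀ hγpos.ne', one_smul]
      exact (hc_t.smul (hRy' y)).add (hT_t.const_smul r)
    change L.1 (y, r) = _
    rw [tendsto_nhds_unique hlhs hrhs, aff_apply]
    rfl
  · intro t ht x
    have hLHS : Tendsto (fun n => c n • u (c n ^ 2 * t) (c n • x)) atTop (𝓝 (γ • u (γ ^ 2 * t) (γ • x))) := by
      have hpt : (γ ^ 2 * t, γ • x) ∈ Set.Iio (0 : ℝ) ×ˢ (Set.univ : Set E3) :=
        ⟨mul_neg_of_pos_of_neg (by positivity) ht, trivial⟩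
      have hcont : ContinuousAt (Function.uncurry u) (γ ^ 2 * t, γ • x) :=
        hu.continuousAt ((isOpen_Iio.prod isOpen_univ).mem_nhds hpt)
      have hpair : Tendsto (fun n => (c n ^ 2 * t, c n • x)) atTop (𝓝 (γ ^ 2 * t, γ • x)) :=
        ((hc_t.pow 2).mul_const t).prodMk_nhds (hc_t.smul_const x)
      exact hc_t.smul (hcont.tendsto.comp hpair)
    have hRHS : Tendsto (fun n => R n (u t ((R n).symm (x - b n)))) atTop
        (𝓝 (S (u t (S.symm (x - γ⁻¹ • Tl))))) := by
      have hz : Tendsto (fun n => (R n).symm (x - b n)) atTop (𝓝 (S.symm (x - γ⁻¹ • Tl))) :=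
        tendsto_isometry_symm_apply hRy' (tendsto_const_nhds.sub hb_t)
      have hpt : (t, S.symm (x - γ⁻¹ • Tl)) ∈ Set.Iio (0 : ℝ) ×ˢ (Set.univ : Set E3) := ⟨ht, trivial⟩
      have hcont : ContinuousAt (Function.uncurry u) (t, S.symm (x - γ⁻¹ • Tl)) :=
        hu.continuousAt ((isOpen_Iio.prod isOpen_univ).mem_nhds hpt)
      have hw : Tendsto (fun n => u t ((R n).symm (x - b n))) atTop (𝓝 (u t (S.symm (x - γ⁻¹ • Tl)))) :=
        hcont.tendsto.comp (tendsto_const_nhds.prodMk_nhds hz)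
      exact tendsto_isometry_apply hRy' hw
    have heq : (fun n => c n • u (c n ^ 2 * t) (c n • x)) = fun n => R n (u t ((R n).symm (x - b n))) :=
      funext fun n => hsym n t ht x
    rw [heq] at hLHS
    exact tendsto_nhds_unique hLHS hRHS

end Closed

/-! ### The registered stub -/

/-- **stub 3c-i of line `registered` (crux `ExtremalSpiralSymmetry`, stmt-NavierStokesRegularity-8215):** for a
field `u` continuous on the open slab `t < 0`, the image `Stab(u)` in `𝕍 = End(ℝ³ × ℝ) × ℝ × ℝ` of its group of
rigid parabolic scaling symmetries is closed, contains `1`, is closed under products and has left inverses. -/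
theorem stub_stabiliserClosedSubgroup :
    ∀ (u : ℝ → E3 → E3), ContinuousOn (Function.uncurry u) (Set.Iio 0 ×ˢ Set.univ) →
      IsClosed Stab(u) ∧ (1 : 𝕍) ∈ Stab(u) ∧ (∀ M ∈ Stab(u), ∀ M' ∈ Stab(u), M * M' ∈ Stab(u)) ∧
      (∀ M ∈ Stab(u), ∃ N ∈ Stab(u), N * M = 1) :=
  fun u hu => ⟨isClosed_stab hu, one_mem_stab u, fun _ hM _ hM' => mul_mem_stab u hM hM',
    fun _ hM => exists_left_inv_mem_stab u hM⟩

end Summit.NavierStokesRegularity.NavierStokesRegularity.Theorems.ExtremalSpiralSymmetry.Registered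

end
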